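import Summits.QuantumFields.BalabanUV.Beta.GAN24.TransportRowsRoot
import Summits.QuantumFields.BalabanUV.Beta.GAN24.W3SourceRowsEndRoot
import Summits.QuantumFields.BalabanUV.Beta.GAN24.T2UnitSplitBorder
import Summits.QuantumFields.BalabanUV.Beta.GAN24.T2OfBracketBlockCovariance
import Summits.QuantumFields.BalabanUV.Beta.GAN24.WSlotMixedShape
import Summits.QuantumFields.BalabanUV.Beta.GAN24.KSlotAssembly

/-!
# `BalabanUV.Beta.GAN24.T2ShapeThreeOfF2aRoot` — binder row G-an2-4 / (CONV-C), W-slot road «W3»: «T2Shape» AT `d = 3` MODULO ROW W3-F2a AND THE PIN, AT THE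
# ROOTED BORDER `vh₂SAt (toSite r) Lc` (`r ∈ box (3+1) Lc`) — referee r53 (w9) ROOT ALIGNMENT, row (B) of the row owner's `SLOT-COVERAGE.md` (the β-lead's literal
# `MixedJetTablesPlug.JsBalAn1` / `JsBalAn1Ctr`, road BF-x's family); decl-by-decl twin of leaf-12's `T2ShapeThreeOfF2a`

NOT IN PRINT; OUR PROOF ATTEMPT (row owner b2b-balaban-gan24-p1, gen 6).  [folklore] composition: the proofs of `T2ShapeThreeOfF2a` VERBATIM with an1's base border
`vh₂S 3 Lc = vh₂SAt 0 Lc` replaced by `vh₂SAt (toSite r) Lc`: END #1's socket `TransportRowsRoot.t2Shape_three_of_rows_F3_at`, ROW W3-F4a `W3SourceRowsEndRoot.hb_three_at`,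
ROW W3-F1a leaf-04's `T2UnitSplitBorder.unitS₂_T2Of_eq_transport_add_sum_vh₂SAt_of_mix`, the bracket covariance leaf-11's `T2OfBracketBlockCovariance.bracket_translate_block_an1`,
the wall socket leaf-11's `WSlotMixedShape.hW_three_an1_of_T2Shape` (generic `T₂`), the K-slot `KSlotAssembly.convCKWall_holds` — all BY NAME.  Same theorem names as the
base module, in this namespace.  HONEST FRAMING (cell contract, verbatim): «discharging `BetaPertH` makes Bałaban's UV stability UNCONDITIONAL — a real constructive-QFT
result; it is NOT the continuum limit and NOT the Clay problem.»  HONEST DEPENDENCY (verbatim): «continuum YM on T⁴ ⇐ BetaPertH ∧ nine spine estimates (0/9 proved);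
BetaPertH ⇐ (D1) ∧ (D4) ∧ CAP+tail; G-an2-4 gates asym, D1 and NE2/3/4.»  ROW W3-F2a (`hZ`) and the pin stay HYPOTHESES here (F2a at the rooted border is leaf-20's
`WSlotSourceZeroModeHolds.zfree_bracket_an1 … (toSite r)`, plugged downstream); discharges NOTHING of (hW, hWall) by itself; 0 `def`, 0 cite, 0 `def … : Prop`, 0 sorry;
NOT «W-slot closed», NEVER «G-an2-4 closed», NOT (CONV-C) for `G_k/H_k`; NOT BetaPertH, NOT continuum, NOT Clay.
-/

noncomputable section

open Finset
open scoped BigOperators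
open Literature.MathematicalPhysics.QuantumFieldTheory
open Literature.MathematicalPhysics.QuantumFieldTheory.Balaban1983to89
open Literature.MathematicalPhysics.QuantumFieldTheory.Balaban1983to89.Beta
open AffineAveraging (box toSite)
open ExpKernelCalculus (MKer Decays VertexFamily₂ shiftK)
open OneStepResolventKernel (Fib)
open OneStepKernelFamily (KInvStep)
open StepJetData (mfNeg)
open SecondOrderResponse (W2SymOfK LocStencilFM)
open BalabanCompositeJets (LocStencil₂ LocStencil₂.nonneg)
open BalabanStepJetsSucc (mmRead)
open BalabanStepW2 (K3OfK Spure M1 M2Of T2Of WbalOf)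
open AveragingMixedJetTables (vh₂SAt mixFFAt)
open Summit.QuantumFields.BalabanUV.Beta.HessKerDressedUnits (unitK unitS unitW)
open Summit.QuantumFields.BalabanUV.Beta.SecondOrderUnits (unitM unitS₂ unitM₂)
open Summit.QuantumFields.BalabanUV.Beta.MixedJetTablesPlug (hmix_an1)
open Summit.QuantumFields.BalabanUV.Beta.GAN24.CombesThomas (UnitDecayK sfStep smStep)
open Summit.QuantumFields.BalabanUV.Beta.GAN24.StencilSlotOfE3 (one_le_of_two_le)
open Summit.QuantumFields.BalabanUV.Beta.GAN24.Push4Iter (BiTab)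
open Summit.QuantumFields.BalabanUV.Beta.GAN24.BiStencilZeroMode (zmode)
open Summit.QuantumFields.BalabanUV.Beta.GAN24.KSlotAssembly (convCKWall_holds)
open Summit.QuantumFields.BalabanUV.Beta.GAN24.W3SourceRowsEndRoot (hb_three_at)
open Summit.QuantumFields.BalabanUV.Beta.GAN24.T2UnitSplitBorder (unitS₂_T2Of_eq_transport_add_sum_vh₂SAt_of_mix)
open Summit.QuantumFields.BalabanUV.Beta.GAN24.T2OfBracketBlockCovariance (bracket_translate_block_an1)
open Summit.QuantumFields.BalabanUV.Beta.GAN24.WSlotMixedShape (mixFFAt_hfm mixFFAt_hm hW_three_an1_of_T2Shape)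
open Summit.QuantumFields.BalabanUV.Beta.GAN24.TransportIrrelevantSym (zfreeSym_of_zfree)
open Summit.QuantumFields.BalabanUV.Beta.GAN24.TransportRowsRoot (t2Shape_three_of_rows_F3_at)

namespace Summit.QuantumFields.BalabanUV.Beta.GAN24.T2ShapeThreeOfF2aRoot

section Three

variable {Lc : ℕ} [NeZero Lc] {r : Fin (3 + 1) → ℕ}

/-! ## §1 Generic mixed table, ROOTED border `vh₂SAt (toSite r) Lc`: «T2Shape» at `d = 3` modulo ROW W3-F2a and the pin -/

/-- **END #1 COMPOSED BY NAME, generic mixed table, `ZfreeSym` form of ROW W3-F2a**: at `d = 3`, `Lc ≥ 2`, for a mixed table with `LocStencilFM Lc mixFF CM₂ δ₄`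
(`δ₄ > 0`) and no (field, multiplier) ∕ (multiplier, ·) entries, UNDER THE PIN `|cE₂| ≤ Lc^(2(3+1))`: if every source `b♮_m` is jointly `Lc`-covariant with
vanishing BOND-SYMMETRISED field–field charge, then an2's normalised Stage-B family is a `LocStencil₂` family with ONE constant and ONE positive rate («T2Shape»).
ROWS F1a ∕ F3a ∕ F3b ∕ F4a (`mom := 0`) ∕ F4c and the K-slot are plugged BY NAME (see the module docstring); rates: `δin := δb` (F4a's), the F3 pair at that input
rate (`TransportRows`). -/
theorem t2Shape_three_of_F2a_symZ (hLc : 2 ≤ Lc) (hr : r ∈ box (3 + 1) Lc) (cE cVH cΛ cE₂ cB : ℝ) (Tc : Fin 4 → Fin 4 → Fin 4 → Fin 4 → ℝ)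
    {mixFF : BiTab 3} {CM₂ δ₄ : ℝ} (hmix : LocStencilFM Lc mixFF CM₂ δ₄) (hδ₄ : 0 < δ₄)
    (hfm : ∀ κ u ρ w x z (α μ' : Fin (3 + 1)), mixFF κ u ρ w x z (Sum.inl α) (Sum.inr μ') = 0)
    (hm : ∀ κ u ρ w x z (μ' : Fin (3 + 1)) (b : Fib 3), mixFF κ u ρ w x z (Sum.inr μ') b = 0)
    (hpin : |cE₂| ≤ (Lc : ℝ) ^ (2 * (3 + 1)))
    (hZ : ∀ m : ℕ, (∀ κ u κ' u' t, (fun κ u κ' u' =>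
        (cE₂ * (Lc : ℝ) ^ (2 * (3 + 1))) •
            mmRead Lc (K3OfK (unitK (sfStep Lc m) (smStep 3 Lc m) (KInvStep (d := 3) Lc m)) Lc
              (unitS (sfStep Lc m) (smStep 3 Lc m) (Spure 3 Lc cE cVH cΛ m)) (unitM (sfStep Lc m) (smStep 3 Lc m) (M1 3 Lc cΛ m))
              (W2SymOfK (unitK (sfStep Lc m) (smStep 3 Lc m) (KInvStep (d := 3) Lc m)) Lc
                (unitS (sfStep Lc m) (smStep 3 Lc m) (Spure 3 Lc cE cVH cΛ m)) (unitM (sfStep Lc m) (smStep 3 Lc m) (M1 3 Lc cΛ m)) 0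
                (unitM₂ (sfStep Lc m) (smStep 3 Lc m) (M2Of 3 Lc mixFF m))) κ u κ' u')
          + cB • mfNeg ((vh₂SAt (toSite r) Lc) κ u κ' u')) κ (u + (Lc : ℤ) • t) κ' (u' + (Lc : ℤ) • t) = shiftK (-((Lc : ℤ) • t)) ((fun κ u κ' u' =>
        (cE₂ * (Lc : ℝ) ^ (2 * (3 + 1))) •
            mmRead Lc (K3OfK (unitK (sfStep Lc m) (smStep 3 Lc m) (KInvStep (d := 3) Lc m)) Lc
              (unitS (sfStep Lc m) (smStep 3 Lc m) (Spure 3 Lc cE cVH cΛ m)) (unitM (sfStep Lc m) (smStep 3 Lc m) (M1 3 Lc cΛ m))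
              (W2SymOfK (unitK (sfStep Lc m) (smStep 3 Lc m) (KInvStep (d := 3) Lc m)) Lc
                (unitS (sfStep Lc m) (smStep 3 Lc m) (Spure 3 Lc cE cVH cΛ m)) (unitM (sfStep Lc m) (smStep 3 Lc m) (M1 3 Lc cΛ m)) 0
                (unitM₂ (sfStep Lc m) (smStep 3 Lc m) (M2Of 3 Lc mixFF m))) κ u κ' u')
          + cB • mfNeg ((vh₂SAt (toSite r) Lc) κ u κ' u')) κ u κ' u')) ∧
      (∀ κ κ' κ₁ κ₂, zmode Lc (fun κ u κ' u' =>
        (cE₂ * (Lc : ℝ) ^ (2 * (3 + 1))) •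
            mmRead Lc (K3OfK (unitK (sfStep Lc m) (smStep 3 Lc m) (KInvStep (d := 3) Lc m)) Lc
              (unitS (sfStep Lc m) (smStep 3 Lc m) (Spure 3 Lc cE cVH cΛ m)) (unitM (sfStep Lc m) (smStep 3 Lc m) (M1 3 Lc cΛ m))
              (W2SymOfK (unitK (sfStep Lc m) (smStep 3 Lc m) (KInvStep (d := 3) Lc m)) Lc
                (unitS (sfStep Lc m) (smStep 3 Lc m) (Spure 3 Lc cE cVH cΛ m)) (unitM (sfStep Lc m) (smStep 3 Lc m) (M1 3 Lc cΛ m)) 0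
                (unitM₂ (sfStep Lc m) (smStep 3 Lc m) (M2Of 3 Lc mixFF m))) κ u κ' u')
          + cB • mfNeg ((vh₂SAt (toSite r) Lc) κ u κ' u')) κ κ' (Sum.inl κ₁) (Sum.inl κ₂) + zmode Lc (fun κ u κ' u' =>
        (cE₂ * (Lc : ℝ) ^ (2 * (3 + 1))) •
            mmRead Lc (K3OfK (unitK (sfStep Lc m) (smStep 3 Lc m) (KInvStep (d := 3) Lc m)) Lc
              (unitS (sfStep Lc m) (smStep 3 Lc m) (Spure 3 Lc cE cVH cΛ m)) (unitM (sfStep Lc m) (smStep 3 Lc m) (M1 3 Lc cΛ m))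
              (W2SymOfK (unitK (sfStep Lc m) (smStep 3 Lc m) (KInvStep (d := 3) Lc m)) Lc
                (unitS (sfStep Lc m) (smStep 3 Lc m) (Spure 3 Lc cE cVH cΛ m)) (unitM (sfStep Lc m) (smStep 3 Lc m) (M1 3 Lc cΛ m)) 0
                (unitM₂ (sfStep Lc m) (smStep 3 Lc m) (M2Of 3 Lc mixFF m))) κ u κ' u')
          + cB • mfNeg ((vh₂SAt (toSite r) Lc) κ u κ' u')) κ' κ (Sum.inl κ₁) (Sum.inl κ₂) = 0)) :
    ∃ C₂ δ₂ : ℝ, 0 < δ₂ ∧ ∀ j, LocStencil₂ (unitS₂ (sfStep Lc j) (smStep 3 Lc j) (T2Of 3 Lc cE cVH cΛ cE₂ cB Tc (vh₂SAt (toSite r) Lc) mixFF j)) C₂ δ₂ := by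
  have hLc1 : 1 ≤ Lc := one_le_of_two_le hLc
  obtain ⟨C, δ, cK, θ, hδ, -, -, hK, -⟩ := convCKWall_holds (Lc := Lc) hLc
  obtain ⟨Cb, δb, hCb, hδb, hb⟩ := hb_three_at hLc hr cE cVH cΛ cE₂ cB hmix hδ₄ hfm hm
  exact t2Shape_three_of_rows_F3_at hLc hr hK hδ cE cVH cΛ cE₂ cB Tc mixFF
    (fun m => (fun κ u κ' u' =>
        (cE₂ * (Lc : ℝ) ^ (2 * (3 + 1))) •
            mmRead Lc (K3OfK (unitK (sfStep Lc m) (smStep 3 Lc m) (KInvStep (d := 3) Lc m)) Lc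
              (unitS (sfStep Lc m) (smStep 3 Lc m) (Spure 3 Lc cE cVH cΛ m)) (unitM (sfStep Lc m) (smStep 3 Lc m) (M1 3 Lc cΛ m))
              (W2SymOfK (unitK (sfStep Lc m) (smStep 3 Lc m) (KInvStep (d := 3) Lc m)) Lc
                (unitS (sfStep Lc m) (smStep 3 Lc m) (Spure 3 Lc cE cVH cΛ m)) (unitM (sfStep Lc m) (smStep 3 Lc m) (M1 3 Lc cΛ m)) 0
                (unitM₂ (sfStep Lc m) (smStep 3 Lc m) (M2Of 3 Lc mixFF m))) κ u κ' u')
          + cB • mfNeg ((vh₂SAt (toSite r) Lc) κ u κ' u')))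
    (fun _ => (0 : ℝ)) hδb hpin
    (fun n => unitS₂_T2Of_eq_transport_add_sum_vh₂SAt_of_mix cE cVH cΛ cE₂ cB Tc mixFF hLc1 hr ⟨CM₂, δ₄, hδ₄, hmix⟩ n)
    (hb le_rfl) hZ

/-- **END #1 COMPOSED BY NAME, generic mixed table, record-`Zfree` form of ROW W3-F2a** (ref2 r57: jointly `Lc`-covariant ∧ `zmode Lc b♮_m κ κ′ ff = 0`). -/
theorem t2Shape_three_of_F2a (hLc : 2 ≤ Lc) (hr : r ∈ box (3 + 1) Lc) (cE cVH cΛ cE₂ cB : ℝ) (Tc : Fin 4 → Fin 4 → Fin 4 → Fin 4 → ℝ)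
    {mixFF : BiTab 3} {CM₂ δ₄ : ℝ} (hmix : LocStencilFM Lc mixFF CM₂ δ₄) (hδ₄ : 0 < δ₄)
    (hfm : ∀ κ u ρ w x z (α μ' : Fin (3 + 1)), mixFF κ u ρ w x z (Sum.inl α) (Sum.inr μ') = 0)
    (hm : ∀ κ u ρ w x z (μ' : Fin (3 + 1)) (b : Fib 3), mixFF κ u ρ w x z (Sum.inr μ') b = 0)
    (hpin : |cE₂| ≤ (Lc : ℝ) ^ (2 * (3 + 1)))
    (hZ : ∀ m : ℕ, (∀ κ u κ' u' t, (fun κ u κ' u' =>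
        (cE₂ * (Lc : ℝ) ^ (2 * (3 + 1))) •
            mmRead Lc (K3OfK (unitK (sfStep Lc m) (smStep 3 Lc m) (KInvStep (d := 3) Lc m)) Lc
              (unitS (sfStep Lc m) (smStep 3 Lc m) (Spure 3 Lc cE cVH cΛ m)) (unitM (sfStep Lc m) (smStep 3 Lc m) (M1 3 Lc cΛ m))
              (W2SymOfK (unitK (sfStep Lc m) (smStep 3 Lc m) (KInvStep (d := 3) Lc m)) Lc
                (unitS (sfStep Lc m) (smStep 3 Lc m) (Spure 3 Lc cE cVH cΛ m)) (unitM (sfStep Lc m) (smStep 3 Lc m) (M1 3 Lc cΛ m)) 0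
                (unitM₂ (sfStep Lc m) (smStep 3 Lc m) (M2Of 3 Lc mixFF m))) κ u κ' u')
          + cB • mfNeg ((vh₂SAt (toSite r) Lc) κ u κ' u')) κ (u + (Lc : ℤ) • t) κ' (u' + (Lc : ℤ) • t) = shiftK (-((Lc : ℤ) • t)) ((fun κ u κ' u' =>
        (cE₂ * (Lc : ℝ) ^ (2 * (3 + 1))) •
            mmRead Lc (K3OfK (unitK (sfStep Lc m) (smStep 3 Lc m) (KInvStep (d := 3) Lc m)) Lc
              (unitS (sfStep Lc m) (smStep 3 Lc m) (Spure 3 Lc cE cVH cΛ m)) (unitM (sfStep Lc m) (smStep 3 Lc m) (M1 3 Lc cΛ m))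
              (W2SymOfK (unitK (sfStep Lc m) (smStep 3 Lc m) (KInvStep (d := 3) Lc m)) Lc
                (unitS (sfStep Lc m) (smStep 3 Lc m) (Spure 3 Lc cE cVH cΛ m)) (unitM (sfStep Lc m) (smStep 3 Lc m) (M1 3 Lc cΛ m)) 0
                (unitM₂ (sfStep Lc m) (smStep 3 Lc m) (M2Of 3 Lc mixFF m))) κ u κ' u')
          + cB • mfNeg ((vh₂SAt (toSite r) Lc) κ u κ' u')) κ u κ' u')) ∧
      (∀ κ κ' κ₁ κ₂, zmode Lc (fun κ u κ' u' =>
        (cE₂ * (Lc : ℝ) ^ (2 * (3 + 1))) •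
            mmRead Lc (K3OfK (unitK (sfStep Lc m) (smStep 3 Lc m) (KInvStep (d := 3) Lc m)) Lc
              (unitS (sfStep Lc m) (smStep 3 Lc m) (Spure 3 Lc cE cVH cΛ m)) (unitM (sfStep Lc m) (smStep 3 Lc m) (M1 3 Lc cΛ m))
              (W2SymOfK (unitK (sfStep Lc m) (smStep 3 Lc m) (KInvStep (d := 3) Lc m)) Lc
                (unitS (sfStep Lc m) (smStep 3 Lc m) (Spure 3 Lc cE cVH cΛ m)) (unitM (sfStep Lc m) (smStep 3 Lc m) (M1 3 Lc cΛ m)) 0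
                (unitM₂ (sfStep Lc m) (smStep 3 Lc m) (M2Of 3 Lc mixFF m))) κ u κ' u')
          + cB • mfNeg ((vh₂SAt (toSite r) Lc) κ u κ' u')) κ κ' (Sum.inl κ₁) (Sum.inl κ₂) = 0)) :
    ∃ C₂ δ₂ : ℝ, 0 < δ₂ ∧ ∀ j, LocStencil₂ (unitS₂ (sfStep Lc j) (smStep 3 Lc j) (T2Of 3 Lc cE cVH cΛ cE₂ cB Tc (vh₂SAt (toSite r) Lc) mixFF j)) C₂ δ₂ :=
  t2Shape_three_of_F2a_symZ hLc hr cE cVH cΛ cE₂ cB Tc hmix hδ₄ hfm hm hpin (fun m => zfreeSym_of_zfree (Lc := Lc)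
    (X := (fun κ u κ' u' =>
        (cE₂ * (Lc : ℝ) ^ (2 * (3 + 1))) •
            mmRead Lc (K3OfK (unitK (sfStep Lc m) (smStep 3 Lc m) (KInvStep (d := 3) Lc m)) Lc
              (unitS (sfStep Lc m) (smStep 3 Lc m) (Spure 3 Lc cE cVH cΛ m)) (unitM (sfStep Lc m) (smStep 3 Lc m) (M1 3 Lc cΛ m))
              (W2SymOfK (unitK (sfStep Lc m) (smStep 3 Lc m) (KInvStep (d := 3) Lc m)) Lc
                (unitS (sfStep Lc m) (smStep 3 Lc m) (Spure 3 Lc cE cVH cΛ m)) (unitM (sfStep Lc m) (smStep 3 Lc m) (M1 3 Lc cΛ m)) 0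
                (unitM₂ (sfStep Lc m) (smStep 3 Lc m) (M2Of 3 Lc mixFF m))) κ u κ' u')
          + cB • mfNeg ((vh₂SAt (toSite r) Lc) κ u κ' u'))) (hZ m))

end Three

/-! ## §2 an1's mixed table at a box root: the bracket's covariance is free, only the charges remain -/

section An1

variable {Lc : ℕ} [NeZero Lc] {r : Fin (3 + 1) → ℕ}

/-- **END #1 COMPOSED BY NAME FOR an1's MIXED TABLE `mixFFAt (toSite r) Lc` (`r ∈ box (3+1) Lc`), bond-SYMMETRISED charges**: at `d = 3`, `Lc ≥ 2`, UNDER THE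
PIN, «T2Shape» ⇐ `∀ m κ κ′ κ₁ κ₂, zmode Lc b♮_m κ κ′ (inl κ₁) (inl κ₂) + zmode Lc b♮_m κ′ κ (inl κ₁) (inl κ₂) = 0` — the mixed-table shape by
`MixedJetTablesPlug.hmix_an1`, its vanishing blocks by `WSlotMixedShape.mixFFAt_hfm` ∕ `mixFFAt_hm`, the joint block covariance of every `b♮_m` by leaf-11's
`T2OfBracketBlockCovariance.bracket_translate_block_base` with `MixedJetTablesPlug.hmixt_an1`. -/
theorem t2Shape_three_an1_of_F2a_symZ (hLc : 2 ≤ Lc) (hr : r ∈ box (3 + 1) Lc) (cE cVH cΛ cE₂ cB : ℝ) (Tc : Fin 4 → Fin 4 → Fin 4 → Fin 4 → ℝ)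
    (hpin : |cE₂| ≤ (Lc : ℝ) ^ (2 * (3 + 1)))
    (hZ : ∀ m : ℕ, (∀ κ κ' κ₁ κ₂, zmode Lc (fun κ u κ' u' =>
        (cE₂ * (Lc : ℝ) ^ (2 * (3 + 1))) •
            mmRead Lc (K3OfK (unitK (sfStep Lc m) (smStep 3 Lc m) (KInvStep (d := 3) Lc m)) Lc
              (unitS (sfStep Lc m) (smStep 3 Lc m) (Spure 3 Lc cE cVH cΛ m)) (unitM (sfStep Lc m) (smStep 3 Lc m) (M1 3 Lc cΛ m))
              (W2SymOfK (unitK (sfStep Lc m) (smStep 3 Lc m) (KInvStep (d := 3) Lc m)) Lc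
                (unitS (sfStep Lc m) (smStep 3 Lc m) (Spure 3 Lc cE cVH cΛ m)) (unitM (sfStep Lc m) (smStep 3 Lc m) (M1 3 Lc cΛ m)) 0
                (unitM₂ (sfStep Lc m) (smStep 3 Lc m) (M2Of 3 Lc (mixFFAt (toSite r) Lc) m))) κ u κ' u')
          + cB • mfNeg ((vh₂SAt (toSite r) Lc) κ u κ' u')) κ κ' (Sum.inl κ₁) (Sum.inl κ₂) + zmode Lc (fun κ u κ' u' =>
        (cE₂ * (Lc : ℝ) ^ (2 * (3 + 1))) •
            mmRead Lc (K3OfK (unitK (sfStep Lc m) (smStep 3 Lc m) (KInvStep (d := 3) Lc m)) Lc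
              (unitS (sfStep Lc m) (smStep 3 Lc m) (Spure 3 Lc cE cVH cΛ m)) (unitM (sfStep Lc m) (smStep 3 Lc m) (M1 3 Lc cΛ m))
              (W2SymOfK (unitK (sfStep Lc m) (smStep 3 Lc m) (KInvStep (d := 3) Lc m)) Lc
                (unitS (sfStep Lc m) (smStep 3 Lc m) (Spure 3 Lc cE cVH cΛ m)) (unitM (sfStep Lc m) (smStep 3 Lc m) (M1 3 Lc cΛ m)) 0
                (unitM₂ (sfStep Lc m) (smStep 3 Lc m) (M2Of 3 Lc (mixFFAt (toSite r) Lc) m))) κ u κ' u')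
          + cB • mfNeg ((vh₂SAt (toSite r) Lc) κ u κ' u')) κ' κ (Sum.inl κ₁) (Sum.inl κ₂) = 0)) :
    ∃ C₂ δ₂ : ℝ, 0 < δ₂ ∧ ∀ j, LocStencil₂ (unitS₂ (sfStep Lc j) (smStep 3 Lc j) (T2Of 3 Lc cE cVH cΛ cE₂ cB Tc (vh₂SAt (toSite r) Lc) (mixFFAt (toSite r) Lc) j)) C₂ δ₂ := by
  have hLc1 : 1 ≤ Lc := one_le_of_two_le hLc
  obtain ⟨CM₂, δ₄, hδ₄, hmix⟩ := hmix_an1 (d := 3) (Lc := Lc) hLc1 hr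
  exact t2Shape_three_of_F2a_symZ hLc hr cE cVH cΛ cE₂ cB Tc hmix hδ₄ (mixFFAt_hfm _) (mixFFAt_hm _) hpin
    (fun m => ⟨fun κ u κ' u' t => bracket_translate_block_an1 (d := 3) hLc1 (toSite r) (toSite r) cE cVH cΛ cE₂ cB m κ u κ' u' t, hZ m⟩)

/-- **END #1 COMPOSED BY NAME FOR an1's MIXED TABLE, cell charges**: at `d = 3`, `Lc ≥ 2`, `r ∈ box (3+1) Lc`, UNDER THE PIN, «T2Shape» ⇐ ROW W3-F2a's cell
zero modes `∀ m κ κ′ κ₁ κ₂, zmode Lc b♮_m κ κ′ (inl κ₁) (inl κ₂) = 0` (leaf-20's `WSlotSourceZeroModeStep.zmode_bracket_eq_zero` delivers these as a FUNCTION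
of leaf-06's four channel bond sums). -/
theorem t2Shape_three_an1_of_F2a (hLc : 2 ≤ Lc) (hr : r ∈ box (3 + 1) Lc) (cE cVH cΛ cE₂ cB : ℝ) (Tc : Fin 4 → Fin 4 → Fin 4 → Fin 4 → ℝ)
    (hpin : |cE₂| ≤ (Lc : ℝ) ^ (2 * (3 + 1)))
    (hZ : ∀ m : ℕ, (∀ κ κ' κ₁ κ₂, zmode Lc (fun κ u κ' u' =>
        (cE₂ * (Lc : ℝ) ^ (2 * (3 + 1))) •
            mmRead Lc (K3OfK (unitK (sfStep Lc m) (smStep 3 Lc m) (KInvStep (d := 3) Lc m)) Lc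
              (unitS (sfStep Lc m) (smStep 3 Lc m) (Spure 3 Lc cE cVH cΛ m)) (unitM (sfStep Lc m) (smStep 3 Lc m) (M1 3 Lc cΛ m))
              (W2SymOfK (unitK (sfStep Lc m) (smStep 3 Lc m) (KInvStep (d := 3) Lc m)) Lc
                (unitS (sfStep Lc m) (smStep 3 Lc m) (Spure 3 Lc cE cVH cΛ m)) (unitM (sfStep Lc m) (smStep 3 Lc m) (M1 3 Lc cΛ m)) 0
                (unitM₂ (sfStep Lc m) (smStep 3 Lc m) (M2Of 3 Lc (mixFFAt (toSite r) Lc) m))) κ u κ' u')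
          + cB • mfNeg ((vh₂SAt (toSite r) Lc) κ u κ' u')) κ κ' (Sum.inl κ₁) (Sum.inl κ₂) = 0)) :
    ∃ C₂ δ₂ : ℝ, 0 < δ₂ ∧ ∀ j, LocStencil₂ (unitS₂ (sfStep Lc j) (smStep 3 Lc j) (T2Of 3 Lc cE cVH cΛ cE₂ cB Tc (vh₂SAt (toSite r) Lc) (mixFFAt (toSite r) Lc) j)) C₂ δ₂ :=
  t2Shape_three_an1_of_F2a_symZ hLc hr cE cVH cΛ cE₂ cB Tc hpin (fun m κ κ' κ₁ κ₂ => by rw [hZ m, hZ m, add_zero])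

/-! ## §3 The wall's uniform W-row for an2's Stage-B family with an1's mixed table, modulo ROW W3-F2a and the pin -/

/-- **`hW₂` AT `d = 3` MODULO ROW W3-F2a AND THE PIN**: for `Lc ≥ 2`, `r ∈ box (3+1) Lc`, UNDER THE PIN, ROW W3-F2a's cell zero modes of the sources
give the wall's uniform W-row `∃ Cw δW, 0 < δW ∧ ∀ j, VertexFamily₂ (unitW_j (WbalOf 3 Lc cE cVH cΛ (T2Of … (mixFFAt (toSite r) Lc)) (mixFFAt (toSite r) Lc) j)) Lc Cw δW`
(leaf-11's `WSlotMixedShape.hW_three_an1_of_T2Shape` ∘ §2).  The Cauchy row `hW₂all` needs «T2Drift» (END #2) and is NOT touched. -/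
theorem hW_three_an1_of_F2a (hLc : 2 ≤ Lc) (hr : r ∈ box (3 + 1) Lc) (cE cVH cΛ cE₂ cB : ℝ) (Tc : Fin 4 → Fin 4 → Fin 4 → Fin 4 → ℝ)
    (hpin : |cE₂| ≤ (Lc : ℝ) ^ (2 * (3 + 1)))
    (hZ : ∀ m : ℕ, (∀ κ κ' κ₁ κ₂, zmode Lc (fun κ u κ' u' =>
        (cE₂ * (Lc : ℝ) ^ (2 * (3 + 1))) •
            mmRead Lc (K3OfK (unitK (sfStep Lc m) (smStep 3 Lc m) (KInvStep (d := 3) Lc m)) Lc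
              (unitS (sfStep Lc m) (smStep 3 Lc m) (Spure 3 Lc cE cVH cΛ m)) (unitM (sfStep Lc m) (smStep 3 Lc m) (M1 3 Lc cΛ m))
              (W2SymOfK (unitK (sfStep Lc m) (smStep 3 Lc m) (KInvStep (d := 3) Lc m)) Lc
                (unitS (sfStep Lc m) (smStep 3 Lc m) (Spure 3 Lc cE cVH cΛ m)) (unitM (sfStep Lc m) (smStep 3 Lc m) (M1 3 Lc cΛ m)) 0
                (unitM₂ (sfStep Lc m) (smStep 3 Lc m) (M2Of 3 Lc (mixFFAt (toSite r) Lc) m))) κ u κ' u')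
          + cB • mfNeg ((vh₂SAt (toSite r) Lc) κ u κ' u')) κ κ' (Sum.inl κ₁) (Sum.inl κ₂) = 0)) :
    ∃ Cw δW : ℝ, 0 < δW ∧ ∀ j, VertexFamily₂ (unitW (sfStep Lc j) (smStep 3 Lc j)
      (WbalOf 3 Lc cE cVH cΛ (T2Of 3 Lc cE cVH cΛ cE₂ cB Tc (vh₂SAt (toSite r) Lc) (mixFFAt (toSite r) Lc)) (mixFFAt (toSite r) Lc) j)) Lc Cw δW := by
  obtain ⟨C₂, δ₂, hδ₂, hT₂⟩ := t2Shape_three_an1_of_F2a hLc hr cE cVH cΛ cE₂ cB Tc hpin hZ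
  exact hW_three_an1_of_T2Shape hLc hr cE cVH cΛ hT₂ hδ₂

end An1

end Summit.QuantumFields.BalabanUV.Beta.GAN24.T2ShapeThreeOfF2aRoot

end
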